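import Literature.AnabelianGeometry.SemiGraphs.GaloisCoveringTorsor
import Literature.AnabelianGeometry.SemiGraphs.SplitTransport
import Literature.AnabelianGeometry.SemiGraphs.SubgroupPresentationCosetGraph
import Literature.AnabelianGeometry.SemiGraphs.SemiGraphIsoTransport
import HarnessLib

/-!
# The point presentation of a Galois covering inside its automorphism group ([SemiAnbd] Def 2.2 (i), Rmk 2.2.1, §3 p. 41)

Mochizuki, *Semi-graphs of anabelioids*, Publ. RIMS **42** (2006), Def. 2.2 (i) p. 23 ("the vertices of
`𝒢'` that lie over `v` [are] the connected components of `S_v`"; branches ↔ double cosets), Rmk. 2.2.1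
p. 24 (images of `Π_v`, `Π_b` = stabilisers) and §3 proof of Thm. 3.7 (iii) p. 41 (the semi-graphs
`𝒢_{∞,i}` of the Galois tower) [cite: MochizukiSemiAnbd2006, Def. 2.2(i) p.23].

DICTIONARY, part 1 (cell row T54-B, tower third, file T3a-1; plan/GAP-LEDGER.md G-w4d053-1), over
abc-iut-L3-t11's one-level torsor file `GaloisCoveringTorsor.lean`: for a connected covering `S` with
point-transitive endomorphisms (e.g. Galois) and POINT DATA `D : S.PtData` (base points `x_w ∈ S_w` at
every vertex, a reference abutting branch `β e : e → ν e` for every edge), the POINT PRESENTATION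
`D.ptPresentation` of `𝔾` inside `Aut S`: `H_w := ψ_{x_w}(Π_w)`, `M_e := ψ_{x_{ν e}}(Π_{β e})`,
`s_b := t_b⁻¹` with `t_b · x_w = glue_b(glue_{β e}⁻¹ x_{ν e})`; the branch inclusions
`s_b M_e s_b⁻¹ ≤ H_w` are PROVED from the gluing equivariance along both branches and rigidity.  The
isomorphism `D.ptPresentation.cosetGraph ⊥ ≅ S.orbitGraph` is the sequel `CovObjOrbitCosetGraph.lean`.
Nothing here bears on [IUTchIII] Cor. 3.12.
-/

namespace Literature.AnabelianGeometry.SemiGraphs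

namespace ProfiniteSemiGraph

open CategoryTheory
open Literature.AlgebraicGeometry.Frobenioids.QuasiTemperoid.BTempConnected (ρ_one_apply
  ρ_mul_apply ρ_inv_apply ρ_apply_inv)

universe u

variable {𝒢 : ProfiniteSemiGraph.{u}} (S : CovObj 𝒢)
  (hconn : ∀ p q : S.Point, S.SameComponent p q)
  (htrans : ∀ (v : 𝒢.graph.Vertex) (x x' : (S.SV v).obj.V), ∃ σ : S ⟶ S, (σ.fV v).hom.hom x = x')

/-- **Point data** for the presentation of a covering: a base point `x_w ∈ S_w` at every vertex and, for
every edge `e`, a reference branch `β e` of `e` abutting to a vertex `ν e`.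
[cite: MochizukiSemiAnbd2006, Def. 2.2(i) p.23] -/
structure CovObj.PtData (S : CovObj 𝒢) : Type u where
  /-- the base points -/
  x : ∀ w : 𝒢.graph.Vertex, (S.SV w).obj.V
  /-- the reference branch of each edge -/
  β : 𝒢.graph.Edge → 𝒢.graph.Branch
  /-- the reference branch of `e` is a branch of `e` -/
  edgeOf_β : ∀ e, 𝒢.graph.edgeOf (β e) = e
  /-- the vertex the reference branch abuts to -/
  ν : 𝒢.graph.Edge → 𝒢.graph.Vertex
  /-- the reference branch abuts to `ν e` -/
  abuts_β : ∀ e, 𝒢.graph.abuts (β e) = some (ν e)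

variable {S} (D : S.PtData)

/-! ### Automorphisms acting on points: bookkeeping -/

/-- `(σ * τ) · y = σ · (τ · y)` on a vertex fibre. [cite: MochizukiSemiAnbd2006, Def. 2.2(i) p.23] -/
theorem CovObj.aut_mul_fV_apply (σ τ : Aut S) (w : 𝒢.graph.Vertex) (y : (S.SV w).obj.V) :
    ((σ * τ).hom.fV w).hom.hom y = (σ.hom.fV w).hom.hom ((τ.hom.fV w).hom.hom y) := rfl

/-- `(σ * τ) · z = σ · (τ · z)` on an edge fibre. [cite: MochizukiSemiAnbd2006, Def. 2.2(i) p.23] -/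
theorem CovObj.aut_mul_fE_apply (σ τ : Aut S) (e : 𝒢.graph.Edge) (z : (S.SE e).obj.V) :
    ((σ * τ).hom.fE e).hom.hom z = (σ.hom.fE e).hom.hom ((τ.hom.fE e).hom.hom z) := rfl

/-- `1 · y = y` on a vertex fibre. [cite: MochizukiSemiAnbd2006, Def. 2.2(i) p.23] -/
theorem CovObj.aut_one_fV_apply (w : 𝒢.graph.Vertex) (y : (S.SV w).obj.V) :
    ((1 : Aut S).hom.fV w).hom.hom y = y := rfl

/-- Naturality of the inverse gluing under endomorphisms: `σ · glue_b⁻¹ y = glue_b⁻¹ (σ · y)`.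
[cite: MochizukiSemiAnbd2006, Def. 2.2(i) p.23] -/
theorem CovObj.fE_glue_inv (σ : S ⟶ S) (b : 𝒢.graph.Branch) (w : 𝒢.graph.Vertex)
    (hw : 𝒢.graph.abuts b = some w) (y : (S.SV w).obj.V) :
    (σ.fE (𝒢.graph.edgeOf b)).hom.hom ((S.glue b w hw).inv.hom.hom y) =
      (S.glue b w hw).inv.hom.hom ((σ.fV w).hom.hom y) := by
  apply Function.LeftInverse.injective (S.glue_inv_hom b w hw)
  rw [CovHom.glue_fE, S.glue_hom_inv, S.glue_hom_inv]

/-- Equivariance of the inverse gluing: `glue_b⁻¹ (b_*(g) · y) = g · glue_b⁻¹ y`.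
[cite: MochizukiSemiAnbd2006, Def. 2.2(i) p.23] -/
theorem CovObj.glue_inv_ρ (b : 𝒢.graph.Branch) (w : 𝒢.graph.Vertex) (hw : 𝒢.graph.abuts b = some w)
    (g : 𝒢.Ge (𝒢.graph.edgeOf b)) (y : (S.SV w).obj.V) :
    (S.glue b w hw).inv.hom.hom ((S.SV w).obj.ρ (𝒢.brHom b w hw g) y) =
      (S.SE (𝒢.graph.edgeOf b)).obj.ρ g ((S.glue b w hw).inv.hom.hom y) := by
  apply Function.LeftInverse.injective (S.glue_inv_hom b w hw)
  rw [S.glue_hom_inv, S.glue_ρ, S.glue_hom_inv]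

/-- `glueV` on a `Σ`-point in standard form is the gluing. [cite: MochizukiSemiAnbd2006, Def. 2.2(i) p.23] -/
theorem CovObj.glueV_mk (b : 𝒢.graph.Branch) (w : 𝒢.graph.Vertex) (hw : 𝒢.graph.abuts b = some w)
    (z : (S.SE (𝒢.graph.edgeOf b)).obj.V) :
    S.glueV b w hw ⟨𝒢.graph.edgeOf b, z⟩ rfl = (S.glue b w hw).hom.hom.hom z := rfl

/-- Naturality of `glueV` under endomorphisms (`Σ`-point form).
[cite: MochizukiSemiAnbd2006, Def. 2.2(i) p.23] -/
theorem CovObj.fV_glueV (σ : S ⟶ S) (b : 𝒢.graph.Branch) (w : 𝒢.graph.Vertex)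
    (hw : 𝒢.graph.abuts b = some w) (p : Σ e : 𝒢.graph.Edge, (S.SE e).obj.V)
    (hp : p.1 = 𝒢.graph.edgeOf b) :
    (σ.fV w).hom.hom (S.glueV b w hw p hp) = S.glueV b w hw ⟨p.1, (σ.fE p.1).hom.hom p.2⟩ hp := by
  obtain ⟨e, z⟩ := p
  cases hp
  change (σ.fV w).hom.hom ((S.glue b w hw).hom.hom.hom z) =
    (S.glue b w hw).hom.hom.hom ((σ.fE _).hom.hom z)
  rw [CovHom.glue_fE]

/-- `glueOpt` on a `Σ`-point over the edge of `b` (general form of `glueOpt_mk`).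
[cite: MochizukiSemiAnbd2006, Def. 2.2(i) p.23] -/
theorem CovObj.glueOpt_mk' (b : 𝒢.graph.Branch) (w : 𝒢.graph.Vertex) (hw : 𝒢.graph.abuts b = some w)
    (p : Σ e : 𝒢.graph.Edge, (S.SE e).obj.V) (hp : p.1 = 𝒢.graph.edgeOf b) :
    S.glueOpt b w hw (Quot.mk _ p) = some (Quot.mk _ ⟨w, S.glueV b w hw p hp⟩) := by
  obtain ⟨e, z⟩ := p
  cases hp
  exact S.glueOpt_mk b w hw z

/-- Two `Σ`-points of edge fibres in one `Π_e`-orbit, general base. [cite: MochizukiSemiAnbd2006, Def. 2.2(i) p.23] -/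
theorem CovObj.oEdge_mk_ρ (p : Σ e : 𝒢.graph.Edge, (S.SE e).obj.V) (g : 𝒢.Ge p.1) :
    (Quot.mk S.ERel ⟨p.1, (S.SE p.1).obj.ρ g p.2⟩ : S.OEdge) = Quot.mk S.ERel p := by
  obtain ⟨e, z⟩ := p
  exact (Quot.sound (CovObj.ERel.mk e g z)).symm

/-! ### The point presentation -/

/-- The reference point of the edge fibre over `e` through the reference branch: `glue_{β e}⁻¹ x_{ν e}`.
[cite: MochizukiSemiAnbd2006, Def. 2.2(i) p.23] -/
noncomputable def CovObj.PtData.ePt (e : 𝒢.graph.Edge) : (S.SE (𝒢.graph.edgeOf (D.β e))).obj.V :=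
  (S.glue (D.β e) (D.ν e) (D.abuts_β e)).inv.hom.hom (D.x (D.ν e))

/-- The reference point pushed to `S_w` along the branch `b : e → w` (transport along `e(β e) = e(b)`
through `glueV`). [cite: MochizukiSemiAnbd2006, Def. 2.2(i) p.23] -/
noncomputable def CovObj.PtData.brPt (b : 𝒢.graph.Branch) (w : 𝒢.graph.Vertex)
    (hw : 𝒢.graph.abuts b = some w) : (S.SV w).obj.V :=
  S.glueV b w hw ⟨𝒢.graph.edgeOf (D.β (𝒢.graph.edgeOf b)), D.ePt (𝒢.graph.edgeOf b)⟩ (D.edgeOf_β _)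

section Defs

include hconn htrans

/-- The automorphism `t_b` with `t_b · x_w = brPt b` (`b : e → w`), by transitivity.
[cite: MochizukiSemiAnbd2006, Rmk. 2.2.1 p.24] -/
noncomputable def CovObj.PtData.brAut (b : 𝒢.graph.Branch) (w : 𝒢.graph.Vertex)
    (hw : 𝒢.graph.abuts b = some w) : Aut S :=
  (S.exists_aut_fV_eq hconn htrans (D.x w) (D.brPt b w hw)).choose

/-- Defining property of `brAut`. [cite: MochizukiSemiAnbd2006, Rmk. 2.2.1 p.24] -/
theorem CovObj.PtData.brAut_apply (b : 𝒢.graph.Branch) (w : 𝒢.graph.Vertex) (hw : 𝒢.graph.abuts b = some w) :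
    ((D.brAut hconn htrans b w hw).hom.fV w).hom.hom (D.x w) = D.brPt b w hw :=
  (S.exists_aut_fV_eq hconn htrans (D.x w) (D.brPt b w hw)).choose_spec

/-- The branch element `s_b := t_b⁻¹` for an abutting branch, `1` for an open one.
[cite: MochizukiSemiAnbd2006, Rmk. 2.2.1 p.24] -/
noncomputable def CovObj.PtData.brElt (b : 𝒢.graph.Branch) : Aut S :=
  match hb : 𝒢.graph.abuts b with
  | some w => (D.brAut hconn htrans b w hb)⁻¹
  | none => 1

/-- The branch element of an abutting branch. [cite: MochizukiSemiAnbd2006, Rmk. 2.2.1 p.24] -/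
theorem CovObj.PtData.brElt_of_abuts (b : 𝒢.graph.Branch) (w : 𝒢.graph.Vertex)
    (hw : 𝒢.graph.abuts b = some w) :
    D.brElt hconn htrans b = (D.brAut hconn htrans b w hw)⁻¹ := by
  unfold CovObj.PtData.brElt
  split
  · rename_i w' hw'
    cases hw.symm.trans hw'
    rfl
  · rename_i h
    exact absurd (hw.symm.trans h) (by simp)

/-- The edge reference point moves under `ψ_{x_ν}`: `ψ_{x_ν}(β_*(g)) · ePt = g⁻¹ · ePt`.
[cite: MochizukiSemiAnbd2006, Rmk. 2.2.1 p.24] -/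
theorem CovObj.PtData.ptHom_fE_ePt (e : 𝒢.graph.Edge) (g : 𝒢.Ge (𝒢.graph.edgeOf (D.β e))) :
    ((S.ptHom hconn htrans (D.x (D.ν e)) (𝒢.brHom (D.β e) (D.ν e) (D.abuts_β e) g)).hom.fE _).hom.hom
        (D.ePt e) =
      (S.SE _).obj.ρ g⁻¹ (D.ePt e) := by
  unfold CovObj.PtData.ePt
  rw [S.fE_glue_inv, S.ptHom_apply, ← map_inv, S.glue_inv_ρ]

/-- For `m = ψ_{x_ν}(β_*(g))` and any branch `b : e → w`: `t_b⁻¹ m t_b ∈ ψ_{x_w}(Π_w)` (gluing equivariance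
along both branches + rigidity). [cite: MochizukiSemiAnbd2006, Rmk. 2.2.1 p.24] -/
theorem CovObj.PtData.brAut_conj_mem (b : 𝒢.graph.Branch) (w : 𝒢.graph.Vertex) (hw : 𝒢.graph.abuts b = some w)
    (m : Aut S)
    (hm : m ∈ (𝒢.branchSubgroup (D.β (𝒢.graph.edgeOf b)) (D.ν (𝒢.graph.edgeOf b)) (D.abuts_β _)).map
      (S.ptHom hconn htrans (D.x (D.ν (𝒢.graph.edgeOf b))))) :
    (D.brAut hconn htrans b w hw)⁻¹ * m * D.brAut hconn htrans b w hw ∈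
      (S.ptHom hconn htrans (D.x w)).range := by
  obtain ⟨k, ⟨g, hg⟩, rfl⟩ := hm
  obtain rfl : k = 𝒢.brHom _ _ _ g := hg.symm
  -- the transported element of `Π_w`
  refine ⟨(𝒢.brHom b w hw (D.edgeOf_β (𝒢.graph.edgeOf b) ▸ g⁻¹))⁻¹, ?_⟩
  -- it suffices to compare `t * ψ_w(…)` and `m * t` on the base point `x_w`
  have key : D.brAut hconn htrans b w hw *
        S.ptHom hconn htrans (D.x w) (𝒢.brHom b w hw (D.edgeOf_β (𝒢.graph.edgeOf b) ▸ g⁻¹))⁻¹ =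
      S.ptHom hconn htrans (D.x (D.ν (𝒢.graph.edgeOf b)))
          (𝒢.brHom (D.β (𝒢.graph.edgeOf b)) (D.ν (𝒢.graph.edgeOf b)) (D.abuts_β _) g) *
        D.brAut hconn htrans b w hw := by
    refine S.aut_eq_of_fV_eq hconn (D.x w) ?_
    rw [CovObj.aut_mul_fV_apply, CovObj.aut_mul_fV_apply, S.ptHom_inv_apply, CovHom.fV_ρ,
      D.brAut_apply hconn htrans]
    -- right-hand side: `ψ_ν(k) · brPt b = b_*(g⁻¹) · brPt b`
    unfold CovObj.PtData.brPt
    rw [S.fV_glueV]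
    dsimp only
    rw [D.ptHom_fE_ePt hconn htrans]
    exact (S.glueV_ρ b w hw _ (D.edgeOf_β _) g⁻¹ (D.ePt (𝒢.graph.edgeOf b))).symm
  calc S.ptHom hconn htrans (D.x w) (𝒢.brHom b w hw (D.edgeOf_β (𝒢.graph.edgeOf b) ▸ g⁻¹))⁻¹
      = (D.brAut hconn htrans b w hw)⁻¹ * (D.brAut hconn htrans b w hw *
          S.ptHom hconn htrans (D.x w) (𝒢.brHom b w hw (D.edgeOf_β (𝒢.graph.edgeOf b) ▸ g⁻¹))⁻¹) := by
        group
    _ = _ := by rw [key]; group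

/-- **The point presentation of `𝔾` inside `Aut S`**: `H_w := ψ_{x_w}(Π_w)`, `M_e := ψ_{x_{ν e}}(Π_{β e})`,
`s_b := t_b⁻¹`. [cite: MochizukiSemiAnbd2006, Rmk. 2.2.1 p.24] -/
noncomputable def CovObj.PtData.ptPresentation : SemiGraph.SubgroupPresentation 𝒢.graph (Aut S) where
  H w := (S.ptHom hconn htrans (D.x w)).range
  M e := (𝒢.branchSubgroup (D.β e) (D.ν e) (D.abuts_β e)).map (S.ptHom hconn htrans (D.x (D.ν e)))
  s b := D.brElt hconn htrans b
  conj_mem b w hw m hm := by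
    rw [D.brElt_of_abuts hconn htrans b w hw, inv_inv]
    exact D.brAut_conj_mem hconn htrans b w hw m hm

end Defs

/-! ### The comparison morphism `cosetGraph ⊥ ⟶ orbitGraph` -/

/-- `glue_b⁻¹ ∘ glueV_b` is the identity on `Σ`-points over the edge of `b`, at the level of edge-orbits.
[cite: MochizukiSemiAnbd2006, Def. 2.2(i) p.23] -/
theorem CovObj.oEdge_mk_glue_inv_glueV (b : 𝒢.graph.Branch) (w : 𝒢.graph.Vertex)
    (hw : 𝒢.graph.abuts b = some w) (p : Σ e : 𝒢.graph.Edge, (S.SE e).obj.V)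
    (hp : p.1 = 𝒢.graph.edgeOf b) :
    (Quot.mk S.ERel ⟨𝒢.graph.edgeOf b, (S.glue b w hw).inv.hom.hom (S.glueV b w hw p hp)⟩ : S.OEdge) =
      Quot.mk S.ERel p := by
  obtain ⟨e, z⟩ := p
  cases hp
  change (Quot.mk S.ERel ⟨_, (S.glue b w hw).inv.hom.hom ((S.glue b w hw).hom.hom.hom z)⟩ : S.OEdge) = _
  rw [S.glue_inv_hom]

end ProfiniteSemiGraph

end Literature.AnabelianGeometry.SemiGraphs
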